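import Mathlib
import HarnessLib
import Summits.HubbardSuperconductivity.HubbardSuperconductivity.Theorems.KLProgrammeC4aFirstOrderTubePieceJointC1
import Literature.Analysis.FluidPDE.SpaceTimeParametricIntegral

/-!
# Route `KLProgramme` — crux C4a, S3 brick (B4) «(M₁)-PACKAGE» part 1: the tube-piece value and the first-order level box are JOINTLY CONTINUOUS in the
# configuration `(ρ, ϑ)` on the open tube (the measurability half of «the jets themselves are admissible `CoMovingJetsL1Theta` dominators»)

Cell `gate-hubbard-kl`, seat hubbard-kl-k3c3-p3 (g39; row «implicit-function / monotonicity route for μ(n)»).  Located brick for the (C)-closer lane / the `M₁` assembly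
(stub (C) `stub_twoLeg_curvature` of `KLRegimeEngineV17F2`, stmt-HubbardSuperconductivity-20437), base HANDOFF § gen 38 (w96); memo HOME/hubbard-kl-k3c3-p3/SWAP-BY-SYMMETRY.md §6,
K2-FIRST-STEP.md (why the order-one row is the one the |·|-inside interface certifies at natural size).

WHAT.  `…C4aFirstOrderLayerSum.firstOrderLayer_abs_le` and its bumped one-calls bound `∫_{(0,2π]} |LEVEL BOX(θ,ρ,ϑ)| dϑ`, where the level box is the first-order co-moving jet of the tube
piece (`…C4aFirstOrderTubePieceJoint.norm_deriv_tubePiece_joint_eq`); the (A) capstone `…C4aSliceIncrementAssemblyTheta` consumes `CoMovingJetsL1Theta N a r μ K V` + `∫dϑ a θ i ≤ M_i`.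
The missing link (named in `…C4aFirstOrderLayerSum`'s docstring as «the (C)-closer's bridge to `CoMovingJetsL1Theta`'s i = 1 row») is typed here: for the vertex
`V(k,q) = 𝐁_{w⊗w·X}(k+q)` (zone box of a weighted kernel, `…C4aBubbleTubeRepContinuous`) the dominators are THE JETS THEMSELVES — `a θ 0 (ρ,ϑ) = ‖tube piece‖`, `a θ 1 (ρ,ϑ) = |level box|`
— which are admissible because they are jointly continuous in `(ρ,ϑ)` on the open tube (hence measurable) and uniformly bounded (hence integrable on the chart box):
* §1 `continuousOn_iteratedDeriv_one_levelPoint` — the loop velocity `(ρ,s) ↦ ∂ₛΦ(ρ,s)` is jointly continuous on `{|ρ| < r} × ℝ` (joint `C^∞` chart, `…C4aLevelChart`);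
* §2 `continuousOn_firstOrderLevelBox_cfg`, `continuousOn_tubePieceValue_cfg` — at fixed base angle `θ`, `(ρ,ϑ) ↦` level box and `(ρ,ϑ) ↦` tube-piece value are continuous on
  `{|ρ| < r} × ℝ` (parametric interval integrals, `Literature…continuousOn_parametric_intervalIntegral`, loop level clamped to `[−hi,hi]`);
* (part 2, `…C4aFirstOrderTubePieceL1Theta`: the uniform bounds and the HEADLINE `coMovingJetsL1Theta_one_tubePiece`.)
Sizes binder shape of B-1 (xii); nothing about the model's sizes; nothing asserts (C), K3, the window or superconductivity.
References: BGM 2006 §2.4 (2.36)/(2.40) [cite: BenfattoGiulianiMastropietro2006]; FST II CPAM 51 (1998) §3 Thm 3.5 [cite: FeldmanSalmhoferTrubowitz1998].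
-/

noncomputable section

namespace Summit.HubbardSuperconductivity.HubbardSuperconductivity.Theorems.C4a

set_option linter.dupNamespace false -- summit = problem name (single-conjunct summit), D-0017

open Real Set Filter MeasureTheory intervalIntegral Metric
open scoped Topology Interval
open Literature.MathematicalPhysics.QuantumLattice Literature.MathematicalPhysics.QuantumLattice.BandSectorCounting Literature.Probability.LatticeModels
open Summit.HubbardSuperconductivity.HubbardSuperconductivity.Theorems.KLRegimeSplit
open Summit.HubbardSuperconductivity.HubbardSuperconductivity.Theorems.DispersionFlow
open Summit.HubbardSuperconductivity.HubbardSuperconductivity.Theorems.PerturbedFermiCurve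

section Sizes

variable {K : TrigPolyC4v} {A : ℝ} (hA : ∀ p : Momentum, ∀ j ≤ 2, ‖iteratedFDeriv ℝ j (frameShift K) p‖ ≤ A) (hA20 : A ≤ 1 / 20)
  (hd : klCurveD ≤ (bandBounds (show (-4 : ℝ) < -1.1 by norm_num) (show (-1.1 : ℝ) ≤ -0.1 by norm_num)
    (show (-0.1 : ℝ) < 0 by norm_num)).Dtmin - 2 * A)
  {μ r : ℝ} (hr : 0 < r) (hlo : (-1.1 : ℝ) < μ - r - A) (hhi : μ + r + A < -0.1)
  {A₃ A₄ : ℝ} (hA₃ : ∀ p : Momentum, ‖iteratedFDeriv ℝ 3 (frameShift K) p‖ ≤ A₃)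
  (hA₄ : ∀ p : Momentum, ‖iteratedFDeriv ℝ 4 (frameShift K) p‖ ≤ A₄)
  {K₁ : ℝ} (hK₁ : ∀ p : Momentum, ‖fderiv ℝ (frameLevel μ K) p‖ ≤ K₁)
include hA hA20 hd hr hlo hhi hA₃ hA₄ hK₁

/-! ## §1 The loop velocity is jointly continuous in (level, angle) -/

omit hA20 hr hA₃ hA₄ hK₁ in
/-- **`(ρ, s) ↦ ∂ₛΦ(ρ, s)` is jointly continuous on the open tube `{|ρ| < r} × ℝ`**: the angular derivative of the level point is the joint Fréchet derivative of the `C^∞`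
chart applied to `(0, 1)`. -/
theorem continuousOn_iteratedDeriv_one_levelPoint :
    ContinuousOn (fun p : ℝ × ℝ => iteratedDeriv 1 (levelPoint μ K p.1) p.2) ({x : ℝ | |x| < r} ×ˢ univ) := by
  set B := bandBounds (show (-4 : ℝ) < -1.1 by norm_num) (show (-1.1 : ℝ) ≤ -0.1 by norm_num) (show (-0.1 : ℝ) < 0 by norm_num) with hBdef
  have hADt : 2 * A < B.Dtmin := by have := klCurveD_pos; linarith only [this, hd]
  have hopen : IsOpen ({x : ℝ | |x| < r} ×ˢ (univ : Set ℝ)) :=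
    (isOpen_lt continuous_abs continuous_const).prod isOpen_univ
  have hC1 : ContDiffOn ℝ 1 (fun p : ℝ × ℝ => levelPoint μ K p.1 p.2) ({x : ℝ | |x| < r} ×ˢ univ) :=
    (contDiffOn_levelPoint B hA hADt hlo hhi (m := 1))
  have hDc : ContinuousOn (fun p : ℝ × ℝ => fderiv ℝ (fun p : ℝ × ℝ => levelPoint μ K p.1 p.2) p) ({x : ℝ | |x| < r} ×ˢ univ) :=
    hC1.continuousOn_fderiv_of_isOpen hopen le_rfl
  have happ : ContinuousOn (fun p : ℝ × ℝ => (fderiv ℝ (fun p : ℝ × ℝ => levelPoint μ K p.1 p.2) p) ((0 : ℝ), (1 : ℝ)))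
      ({x : ℝ | |x| < r} ×ˢ univ) := hDc.clm_apply continuousOn_const
  refine happ.congr fun p hp => ?_
  -- at a point of the open tube the partial derivative is the joint derivative applied to `(0,1)`
  have hdiff : DifferentiableAt ℝ (fun p : ℝ × ℝ => levelPoint μ K p.1 p.2) p :=
    (hC1.differentiableOn (by simp) p hp).differentiableAt (hopen.mem_nhds hp)
  have hinner : HasDerivAt (fun s : ℝ => ((p.1, s) : ℝ × ℝ)) ((0 : ℝ), (1 : ℝ)) p.2 :=
    (hasDerivAt_const p.2 p.1).prodMk (hasDerivAt_id p.2)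
  have hcomp : HasDerivAt ((fun p : ℝ × ℝ => levelPoint μ K p.1 p.2) ∘ fun s : ℝ => ((p.1, s) : ℝ × ℝ))
      ((fderiv ℝ (fun p : ℝ × ℝ => levelPoint μ K p.1 p.2) p) ((0 : ℝ), (1 : ℝ))) p.2 :=
    hdiff.hasFDerivAt.comp_hasDerivAt p.2 hinner
  have hfun : (levelPoint μ K p.1) = ((fun p : ℝ × ℝ => levelPoint μ K p.1 p.2) ∘ fun s : ℝ => ((p.1, s) : ℝ × ℝ)) := rfl
  rw [iteratedDeriv_one, hfun]
  exact hcomp.deriv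

/-! ## §2 Joint continuity of the level box and of the value in the configuration `(ρ, ϑ)` -/

omit hA20 hr hA₃ hA₄ hK₁ in
set_option maxHeartbeats 400000 in
/-- **The first-order LEVEL BOX is jointly continuous in the configuration `(ρ,ϑ)`** on the open tube, at every base angle `θ`: for `f` continuous on `[−hi,hi]` and `∂ᵤK` jointly
continuous, `(ρ,ϑ) ↦ ∫_{−hi}^{hi} f(e)·(∫_{−π}^{π} J(e,v+θ)·G(ρ,ϑ,θ,e,v)·(K e)′(ē) dv) de` is continuous on `{|ρ| < r} × ℝ`. -/
theorem continuousOn_firstOrderLevelBox_cfg (θ : ℝ) {hi : ℝ} (hhi0 : 0 ≤ hi) (hhir : hi < r) {f : ℝ → ℝ}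
    (hfc : ContinuousOn f (Icc (-hi) hi)) {Kr : ℝ → ℝ → ℝ} (hKc : Continuous fun p : ℝ × ℝ => deriv (Kr p.1) p.2) :
    ContinuousOn (fun p : ℝ × ℝ => ∫ e in (-hi)..hi, f e * ∫ v in (-π)..π, levelChartJac μ K (e, v + θ) *
        (fderiv ℝ (frameLevel μ K) (pairSumPath μ K p.1 p.2 θ 0 - levelPoint μ K e (v + θ)))
          (iteratedDeriv 1 (levelPoint μ K 0) θ + iteratedDeriv 1 (levelPoint μ K p.1) (p.2 + θ)) *
        deriv (Kr e) (frameLevel μ K (pairSumPath μ K p.1 p.2 θ 0 - levelPoint μ K e (v + θ)))) ({x : ℝ | |x| < r} ×ˢ univ) := by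
  set B := bandBounds (show (-4 : ℝ) < -1.1 by norm_num) (show (-1.1 : ℝ) ≤ -0.1 by norm_num) (show (-0.1 : ℝ) < 0 by norm_num) with hBdef
  have hADt : 2 * A < B.Dtmin := by have := klCurveD_pos; linarith only [this, hd]
  set D : Set (ℝ × ℝ) := {x : ℝ | |x| < r} ×ˢ univ with hDdef
  have hlev : ContinuousOn (fun p : ℝ × ℝ => levelPoint μ K p.1 p.2) ({x : ℝ | |x| < r} ×ˢ univ) :=
    (contDiffOn_levelPoint B hA hADt hlo hhi (m := 0)).continuousOn
  have hjac : ContinuousOn (levelChartJac μ K) ({x : ℝ | |x| < r} ×ˢ univ) := (contDiffOn_levelChartJac B hA hADt hlo hhi).continuousOn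
  have hvel := continuousOn_iteratedDeriv_one_levelPoint hA hd hlo hhi
  have hfl : Continuous (frameLevel μ K) := (EngineV8.contDiff_frameLevel μ K (n := 0)).continuous
  have hDfl : Continuous (fderiv ℝ (frameLevel μ K)) := (EngineV8.contDiff_frameLevel μ K (n := 1)).continuous_fderiv one_ne_zero
  have hhh : -hi ≤ hi := by linarith only [hhi0]
  -- variables of the inner integral: `t = (v, (p, e))`, `p = (ρ, ϑ)`; the loop level clamped to `[−hi, hi]`
  have hcl : Continuous fun t : ℝ × ((ℝ × ℝ) × ℝ) => max (-hi) (min t.2.2 hi) :=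
    continuous_const.max ((continuous_snd.comp continuous_snd).min continuous_const)
  have hclI : ∀ t : ℝ × ((ℝ × ℝ) × ℝ), max (-hi) (min t.2.2 hi) ∈ Icc (-hi) hi := fun t => ⟨le_max_left _ _, max_le hhh (min_le_right _ _)⟩
  have hclr : ∀ t : ℝ × ((ℝ × ℝ) × ℝ), |max (-hi) (min t.2.2 hi)| < r := fun t =>
    abs_lt.2 ⟨by linarith only [(hclI t).1, hhir], lt_of_le_of_lt (hclI t).2 hhir⟩
  set S : Set (ℝ × ((ℝ × ℝ) × ℝ)) := univ ×ˢ (D ×ˢ univ) with hSdef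
  have hSρ : ∀ t ∈ S, |t.2.1.1| < r := fun t ht => by
    have h1 : t.2 ∈ D ×ˢ (univ : Set ℝ) := (mem_prod.1 ht).2
    have h2 : t.2.1 ∈ D := (mem_prod.1 h1).1
    exact (mem_prod.1 h2).1
  have hv : Continuous fun t : ℝ × ((ℝ × ℝ) × ℝ) => t.1 := continuous_fst
  have hρc : Continuous fun t : ℝ × ((ℝ × ℝ) × ℝ) => t.2.1.1 := continuous_fst.comp (continuous_fst.comp continuous_snd)
  have hϑc : Continuous fun t : ℝ × ((ℝ × ℝ) × ℝ) => t.2.1.2 := continuous_snd.comp (continuous_fst.comp continuous_snd)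
  -- the loop point `Φ(ẽ, v + θ)` and the Jacobian `J(ẽ, v + θ)` (continuous everywhere after the clamp)
  have hL := hlev.comp_continuous (f := fun t : ℝ × ((ℝ × ℝ) × ℝ) => ((max (-hi) (min t.2.2 hi), t.1 + θ) : ℝ × ℝ))
    (hcl.prodMk (hv.add continuous_const)) fun t => mem_prod.2 ⟨hclr t, mem_univ _⟩
  have hL' : Continuous fun t : ℝ × ((ℝ × ℝ) × ℝ) => levelPoint μ K (max (-hi) (min t.2.2 hi)) (t.1 + θ) := hL.congr fun _ => rfl
  have hJ := hjac.comp_continuous (f := fun t : ℝ × ((ℝ × ℝ) × ℝ) => ((max (-hi) (min t.2.2 hi), t.1 + θ) : ℝ × ℝ))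
    (hcl.prodMk (hv.add continuous_const)) fun t => mem_prod.2 ⟨hclr t, mem_univ _⟩
  have hJ' : Continuous fun t : ℝ × ((ℝ × ℝ) × ℝ) => levelChartJac μ K (max (-hi) (min t.2.2 hi), t.1 + θ) := hJ.congr fun _ => rfl
  -- the co-moving pair momentum `S(ρ,ϑ) = Φ(0,θ) + Φ(ρ,ϑ+θ)` and the velocity `Φ′(0,θ) + ∂ₛΦ(ρ,ϑ+θ)` (continuous on `S`)
  have hf3 : Continuous fun t : ℝ × ((ℝ × ℝ) × ℝ) => ((t.2.1.1, t.2.1.2 + θ) : ℝ × ℝ) := hρc.prodMk (hϑc.add continuous_const)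
  have hmaps3 : MapsTo (fun t : ℝ × ((ℝ × ℝ) × ℝ) => ((t.2.1.1, t.2.1.2 + θ) : ℝ × ℝ)) S ({x : ℝ | |x| < r} ×ˢ (univ : Set ℝ)) :=
    fun t ht => mem_prod.2 ⟨hSρ t ht, mem_univ _⟩
  have hP0 := hlev.comp hf3.continuousOn hmaps3
  have hP : ContinuousOn (fun t : ℝ × ((ℝ × ℝ) × ℝ) => levelPoint μ K t.2.1.1 (t.2.1.2 + θ)) S := hP0.congr fun _ _ => rfl
  have hSc : ContinuousOn (fun t : ℝ × ((ℝ × ℝ) × ℝ) => pairSumPath μ K t.2.1.1 t.2.1.2 θ 0) S := by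
    have h : ContinuousOn (fun t : ℝ × ((ℝ × ℝ) × ℝ) => levelPoint μ K 0 θ + levelPoint μ K t.2.1.1 (t.2.1.2 + θ)) S :=
      continuousOn_const.add hP
    refine h.congr fun t _ => ?_
    simp only [pairSumPath, add_zero]
  have hV0 := hvel.comp hf3.continuousOn hmaps3
  have hV : ContinuousOn (fun t : ℝ × ((ℝ × ℝ) × ℝ) => iteratedDeriv 1 (levelPoint μ K t.2.1.1) (t.2.1.2 + θ)) S := hV0.congr fun _ _ => rfl
  have hvec : ContinuousOn (fun t : ℝ × ((ℝ × ℝ) × ℝ) => iteratedDeriv 1 (levelPoint μ K 0) θ + iteratedDeriv 1 (levelPoint μ K t.2.1.1) (t.2.1.2 + θ)) S :=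
    continuousOn_const.add hV
  have harg : ContinuousOn (fun t : ℝ × ((ℝ × ℝ) × ℝ) => pairSumPath μ K t.2.1.1 t.2.1.2 θ 0 - levelPoint μ K (max (-hi) (min t.2.2 hi)) (t.1 + θ)) S :=
    hSc.sub hL'.continuousOn
  have hband : ContinuousOn (fun t : ℝ × ((ℝ × ℝ) × ℝ) =>
      frameLevel μ K (pairSumPath μ K t.2.1.1 t.2.1.2 θ 0 - levelPoint μ K (max (-hi) (min t.2.2 hi)) (t.1 + θ))) S :=
    hfl.comp_continuousOn harg
  have hGf : ContinuousOn (fun t : ℝ × ((ℝ × ℝ) × ℝ) =>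
      (fderiv ℝ (frameLevel μ K) (pairSumPath μ K t.2.1.1 t.2.1.2 θ 0 - levelPoint μ K (max (-hi) (min t.2.2 hi)) (t.1 + θ)))
        (iteratedDeriv 1 (levelPoint μ K 0) θ + iteratedDeriv 1 (levelPoint μ K t.2.1.1) (t.2.1.2 + θ))) S :=
    (hDfl.comp_continuousOn harg).clm_apply hvec
  have hKcl : ContinuousOn (fun t : ℝ × ((ℝ × ℝ) × ℝ) => deriv (Kr (max (-hi) (min t.2.2 hi)))
      (frameLevel μ K (pairSumPath μ K t.2.1.1 t.2.1.2 θ 0 - levelPoint μ K (max (-hi) (min t.2.2 hi)) (t.1 + θ)))) S :=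
    (hKc.comp_continuousOn (hcl.continuousOn.prodMk hband)).congr fun _ _ => rfl
  -- the inner integrand `H₁ (v, (p, e))` and its parametric integral over `v`
  have hH₁ : ContinuousOn (fun t : ℝ × ((ℝ × ℝ) × ℝ) => levelChartJac μ K (max (-hi) (min t.2.2 hi), t.1 + θ) *
      (fderiv ℝ (frameLevel μ K) (pairSumPath μ K t.2.1.1 t.2.1.2 θ 0 - levelPoint μ K (max (-hi) (min t.2.2 hi)) (t.1 + θ)))
        (iteratedDeriv 1 (levelPoint μ K 0) θ + iteratedDeriv 1 (levelPoint μ K t.2.1.1) (t.2.1.2 + θ)) *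
      deriv (Kr (max (-hi) (min t.2.2 hi))) (frameLevel μ K (pairSumPath μ K t.2.1.1 t.2.1.2 θ 0 - levelPoint μ K (max (-hi) (min t.2.2 hi)) (t.1 + θ)))) S :=
    (hJ'.continuousOn.mul hGf).mul hKcl
  have h1 := Literature.Analysis.FluidPDE.continuousOn_parametric_intervalIntegral (D := D ×ˢ (univ : Set ℝ)) hH₁ (-π) π
  -- the outer integrand `H₂ (e, p) = f(ẽ) · (inner)(p, e)` and its parametric integral over `e`
  have hcl₂ : Continuous fun q : ℝ × (ℝ × ℝ) => max (-hi) (min q.1 hi) := continuous_const.max (continuous_fst.min continuous_const)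
  have hclI₂ : ∀ q : ℝ × (ℝ × ℝ), max (-hi) (min q.1 hi) ∈ Icc (-hi) hi := fun q => ⟨le_max_left _ _, max_le hhh (min_le_right _ _)⟩
  have hf₂ : Continuous fun q : ℝ × (ℝ × ℝ) => f (max (-hi) (min q.1 hi)) := hfc.comp_continuous hcl₂ hclI₂
  have hswap : ContinuousOn (fun q : ℝ × (ℝ × ℝ) => ((q.2, q.1) : (ℝ × ℝ) × ℝ)) (univ ×ˢ D) :=
    (continuous_snd.prodMk continuous_fst).continuousOn
  have hmaps : MapsTo (fun q : ℝ × (ℝ × ℝ) => ((q.2, q.1) : (ℝ × ℝ) × ℝ)) (univ ×ˢ D) (D ×ˢ univ) := fun q hq =>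
    mem_prod.2 ⟨(mem_prod.1 hq).2, mem_univ _⟩
  have hinner := h1.comp hswap hmaps
  have hH₂ : ContinuousOn (fun q : ℝ × (ℝ × ℝ) => f (max (-hi) (min q.1 hi)) *
      ∫ v in (-π)..π, levelChartJac μ K (max (-hi) (min q.1 hi), v + θ) *
        (fderiv ℝ (frameLevel μ K) (pairSumPath μ K q.2.1 q.2.2 θ 0 - levelPoint μ K (max (-hi) (min q.1 hi)) (v + θ)))
          (iteratedDeriv 1 (levelPoint μ K 0) θ + iteratedDeriv 1 (levelPoint μ K q.2.1) (q.2.2 + θ)) *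
        deriv (Kr (max (-hi) (min q.1 hi))) (frameLevel μ K (pairSumPath μ K q.2.1 q.2.2 θ 0 - levelPoint μ K (max (-hi) (min q.1 hi)) (v + θ)))) (univ ×ˢ D) :=
    hf₂.continuousOn.mul (hinner.congr fun _ _ => rfl)
  have h2 := Literature.Analysis.FluidPDE.continuousOn_parametric_intervalIntegral (D := D) hH₂ (-hi) hi
  -- remove the clamp on the integration range
  refine h2.congr fun p _ => ?_
  refine intervalIntegral.integral_congr fun e he => ?_
  have he' : e ∈ Icc (-hi) hi := by rwa [uIcc_of_le hhh] at he
  have hce : max (-hi) (min e hi) = e := by rw [min_eq_left he'.2, max_eq_right he'.1]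
  simp only [hce]

omit hA20 hr hA₃ hA₄ hK₁ in
set_option maxHeartbeats 400000 in
/-- **The tube-piece VALUE is jointly continuous in the configuration `(ρ,ϑ)`** on the open tube, at every base angle `θ`: for `f` continuous on `[−hi,hi]` and `K` jointly continuous,
`(ρ,ϑ) ↦ ∫_{−hi}^{hi} f(e)·(∫_{(−π,π)} J(e,φ+θ) • K e(ē) dφ) de` is continuous on `{|ρ| < r} × ℝ`. -/
theorem continuousOn_tubePieceValue_cfg (θ : ℝ) {hi : ℝ} (hhi0 : 0 ≤ hi) (hhir : hi < r) {f : ℝ → ℝ}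
    (hfc : ContinuousOn f (Icc (-hi) hi)) {Kr : ℝ → ℝ → ℝ} (hKc0 : Continuous fun p : ℝ × ℝ => Kr p.1 p.2) :
    ContinuousOn (fun p : ℝ × ℝ => ∫ e in (-hi)..hi, ((f e : ℝ) : ℂ) * ∫ φ in Ioo (-π) π,
        (levelChartJac μ K (e, φ + θ) : ℝ) • ((Kr e (frameLevel μ K (levelPoint μ K 0 θ + levelPoint μ K p.1 (p.2 + θ) - levelPoint μ K e (φ + θ))) : ℝ) : ℂ))
      ({x : ℝ | |x| < r} ×ˢ univ) := by
  set B := bandBounds (show (-4 : ℝ) < -1.1 by norm_num) (show (-1.1 : ℝ) ≤ -0.1 by norm_num) (show (-0.1 : ℝ) < 0 by norm_num) with hBdef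
  have hADt : 2 * A < B.Dtmin := by have := klCurveD_pos; linarith only [this, hd]
  set D : Set (ℝ × ℝ) := {x : ℝ | |x| < r} ×ˢ univ with hDdef
  have hlev : ContinuousOn (fun p : ℝ × ℝ => levelPoint μ K p.1 p.2) ({x : ℝ | |x| < r} ×ˢ univ) :=
    (contDiffOn_levelPoint B hA hADt hlo hhi (m := 0)).continuousOn
  have hjac : ContinuousOn (levelChartJac μ K) ({x : ℝ | |x| < r} ×ˢ univ) := (contDiffOn_levelChartJac B hA hADt hlo hhi).continuousOn
  have hfl : Continuous (frameLevel μ K) := (EngineV8.contDiff_frameLevel μ K (n := 0)).continuous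
  have hhh : -hi ≤ hi := by linarith only [hhi0]
  have hcl : Continuous fun t : ℝ × ((ℝ × ℝ) × ℝ) => max (-hi) (min t.2.2 hi) :=
    continuous_const.max ((continuous_snd.comp continuous_snd).min continuous_const)
  have hclI : ∀ t : ℝ × ((ℝ × ℝ) × ℝ), max (-hi) (min t.2.2 hi) ∈ Icc (-hi) hi := fun t => ⟨le_max_left _ _, max_le hhh (min_le_right _ _)⟩
  have hclr : ∀ t : ℝ × ((ℝ × ℝ) × ℝ), |max (-hi) (min t.2.2 hi)| < r := fun t =>
    abs_lt.2 ⟨by linarith only [(hclI t).1, hhir], lt_of_le_of_lt (hclI t).2 hhir⟩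
  set S : Set (ℝ × ((ℝ × ℝ) × ℝ)) := univ ×ˢ (D ×ˢ univ) with hSdef
  have hSρ : ∀ t ∈ S, |t.2.1.1| < r := fun t ht => by
    have h1 : t.2 ∈ D ×ˢ (univ : Set ℝ) := (mem_prod.1 ht).2
    have h2 : t.2.1 ∈ D := (mem_prod.1 h1).1
    exact (mem_prod.1 h2).1
  have hv : Continuous fun t : ℝ × ((ℝ × ℝ) × ℝ) => t.1 := continuous_fst
  have hρc : Continuous fun t : ℝ × ((ℝ × ℝ) × ℝ) => t.2.1.1 := continuous_fst.comp (continuous_fst.comp continuous_snd)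
  have hϑc : Continuous fun t : ℝ × ((ℝ × ℝ) × ℝ) => t.2.1.2 := continuous_snd.comp (continuous_fst.comp continuous_snd)
  have hL := hlev.comp_continuous (f := fun t : ℝ × ((ℝ × ℝ) × ℝ) => ((max (-hi) (min t.2.2 hi), t.1 + θ) : ℝ × ℝ))
    (hcl.prodMk (hv.add continuous_const)) fun t => mem_prod.2 ⟨hclr t, mem_univ _⟩
  have hL' : Continuous fun t : ℝ × ((ℝ × ℝ) × ℝ) => levelPoint μ K (max (-hi) (min t.2.2 hi)) (t.1 + θ) := hL.congr fun _ => rfl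
  have hJ := hjac.comp_continuous (f := fun t : ℝ × ((ℝ × ℝ) × ℝ) => ((max (-hi) (min t.2.2 hi), t.1 + θ) : ℝ × ℝ))
    (hcl.prodMk (hv.add continuous_const)) fun t => mem_prod.2 ⟨hclr t, mem_univ _⟩
  have hJ' : Continuous fun t : ℝ × ((ℝ × ℝ) × ℝ) => levelChartJac μ K (max (-hi) (min t.2.2 hi), t.1 + θ) := hJ.congr fun _ => rfl
  have hf3 : Continuous fun t : ℝ × ((ℝ × ℝ) × ℝ) => ((t.2.1.1, t.2.1.2 + θ) : ℝ × ℝ) := hρc.prodMk (hϑc.add continuous_const)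
  have hmaps3 : MapsTo (fun t : ℝ × ((ℝ × ℝ) × ℝ) => ((t.2.1.1, t.2.1.2 + θ) : ℝ × ℝ)) S ({x : ℝ | |x| < r} ×ˢ (univ : Set ℝ)) :=
    fun t ht => mem_prod.2 ⟨hSρ t ht, mem_univ _⟩
  have hP0 := hlev.comp hf3.continuousOn hmaps3
  have hP : ContinuousOn (fun t : ℝ × ((ℝ × ℝ) × ℝ) => levelPoint μ K t.2.1.1 (t.2.1.2 + θ)) S := hP0.congr fun _ _ => rfl
  have harg : ContinuousOn (fun t : ℝ × ((ℝ × ℝ) × ℝ) =>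
      levelPoint μ K 0 θ + levelPoint μ K t.2.1.1 (t.2.1.2 + θ) - levelPoint μ K (max (-hi) (min t.2.2 hi)) (t.1 + θ)) S :=
    (continuousOn_const.add hP).sub hL'.continuousOn
  have hband : ContinuousOn (fun t : ℝ × ((ℝ × ℝ) × ℝ) =>
      frameLevel μ K (levelPoint μ K 0 θ + levelPoint μ K t.2.1.1 (t.2.1.2 + θ) - levelPoint μ K (max (-hi) (min t.2.2 hi)) (t.1 + θ))) S :=
    hfl.comp_continuousOn harg
  have hKcl : ContinuousOn (fun t : ℝ × ((ℝ × ℝ) × ℝ) => Kr (max (-hi) (min t.2.2 hi))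
      (frameLevel μ K (levelPoint μ K 0 θ + levelPoint μ K t.2.1.1 (t.2.1.2 + θ) - levelPoint μ K (max (-hi) (min t.2.2 hi)) (t.1 + θ)))) S :=
    (hKc0.comp_continuousOn (hcl.continuousOn.prodMk hband)).congr fun _ _ => rfl
  have hH₁ : ContinuousOn (fun t : ℝ × ((ℝ × ℝ) × ℝ) => ((levelChartJac μ K (max (-hi) (min t.2.2 hi), t.1 + θ) : ℝ) •
      ((Kr (max (-hi) (min t.2.2 hi))
        (frameLevel μ K (levelPoint μ K 0 θ + levelPoint μ K t.2.1.1 (t.2.1.2 + θ) - levelPoint μ K (max (-hi) (min t.2.2 hi)) (t.1 + θ))) : ℝ) : ℂ))) S :=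
    hJ'.continuousOn.smul (Complex.continuous_ofReal.comp_continuousOn hKcl)
  have h1 := Literature.Analysis.FluidPDE.continuousOn_parametric_intervalIntegral (D := D ×ˢ (univ : Set ℝ)) hH₁ (-π) π
  have hcl₂ : Continuous fun q : ℝ × (ℝ × ℝ) => max (-hi) (min q.1 hi) := continuous_const.max (continuous_fst.min continuous_const)
  have hclI₂ : ∀ q : ℝ × (ℝ × ℝ), max (-hi) (min q.1 hi) ∈ Icc (-hi) hi := fun q => ⟨le_max_left _ _, max_le hhh (min_le_right _ _)⟩
  have hf₂ : Continuous fun q : ℝ × (ℝ × ℝ) => ((f (max (-hi) (min q.1 hi)) : ℝ) : ℂ) :=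
    Complex.continuous_ofReal.comp (hfc.comp_continuous hcl₂ hclI₂)
  have hswap : ContinuousOn (fun q : ℝ × (ℝ × ℝ) => ((q.2, q.1) : (ℝ × ℝ) × ℝ)) (univ ×ˢ D) :=
    (continuous_snd.prodMk continuous_fst).continuousOn
  have hmaps : MapsTo (fun q : ℝ × (ℝ × ℝ) => ((q.2, q.1) : (ℝ × ℝ) × ℝ)) (univ ×ˢ D) (D ×ˢ univ) := fun q hq =>
    mem_prod.2 ⟨(mem_prod.1 hq).2, mem_univ _⟩
  have hinner := h1.comp hswap hmaps
  have hH₂ : ContinuousOn (fun q : ℝ × (ℝ × ℝ) => ((f (max (-hi) (min q.1 hi)) : ℝ) : ℂ) *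
      ∫ φ in (-π)..π, ((levelChartJac μ K (max (-hi) (min q.1 hi), φ + θ) : ℝ) •
        ((Kr (max (-hi) (min q.1 hi))
          (frameLevel μ K (levelPoint μ K 0 θ + levelPoint μ K q.2.1 (q.2.2 + θ) - levelPoint μ K (max (-hi) (min q.1 hi)) (φ + θ))) : ℝ) : ℂ)))
      (univ ×ˢ D) :=
    hf₂.continuousOn.mul (hinner.congr fun _ _ => rfl)
  have h2 := Literature.Analysis.FluidPDE.continuousOn_parametric_intervalIntegral (D := D) hH₂ (-hi) hi
  refine h2.congr fun p _ => ?_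
  refine intervalIntegral.integral_congr fun e he => ?_
  have he' : e ∈ Icc (-hi) hi := by rwa [uIcc_of_le hhh] at he
  have hce : max (-hi) (min e hi) = e := by rw [min_eq_left he'.2, max_eq_right he'.1]
  simp only [hce, intervalIntegral.integral_of_le (show -π ≤ π by linarith [pi_pos]), integral_Ioc_eq_integral_Ioo]


end Sizes

end Summit.HubbardSuperconductivity.HubbardSuperconductivity.Theorems.C4a

end
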